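import Mathlib.Analysis.Asymptotics.Theta
import Mathlib.Analysis.SpecialFunctions.Pow.Real
import Mathlib.Analysis.SpecialFunctions.Pow.Asymptotics
import Mathlib.Analysis.SpecialFunctions.Exp
import Mathlib.Algebra.BigOperators.Ring.Finset
import Mathlib.Data.Finset.Powerset
import Mathlib.Combinatorics.SimpleGraph.Finite
import Literature.Computability.Complexity.CliqueTestGraphs
import Literature.Computability.Complexity.NegationElimination
import Literature.Computability.Complexity.Rossman2008
import HarnessLib

/-!
# The monotone complexity of `k`-CLIQUE on random graphs (Rossman, FOCS 2010 / SICOMP 2014)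

Named facts (statements `def … : Prop`, not proved here) for the four results of

* B. Rossman, *The monotone complexity of k-clique on random graphs*, FOCS 2010, 193–201
  [Rossman2010]; journal version SIAM J. Comput. 43 (2014) 256–279 [Rossman2014].

All locators (Theorem 1, 2, 3, Lemma 23, page numbers) refer to the author's full version dated
2009-11-05 (15 pp., the held text `paper:doi-10-1109-focs-2010-26`), whose §3 "Results" is p. 4,
§7–§9 pp. 10–11 and Appendix B (Lemma 23) pp. 13–14.

Throughout, `k ≥ 5` is a fixed constant (§2, p. 3: "Let `k` be a fixed constant `⩾ 5`"), graphs
on `[n]` are edge-indicator vectors `x : (⊤ : SimpleGraph (Fin n)).edgeSet → Bool` (the input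
type of `cliqueFn`, `CircuitLowerBounds.lean`), `G(n, p)` is the Erdős–Rényi graph (each of the
`C(n,2)` edges present independently with probability `p`), the *random `k`-clique* is `K_A` for a
uniformly random `A ∈ ([n] choose k)`, `ω_k(G)` is the number of `k`-cliques of `G`, and a
Boolean function `f` *solves `k`-clique a.a.s. on `G(n,p)`* if `Pr[f(G) = 1 ⇔ ω_k(G) ≥ 1] → 1`
(§2, p. 4).

* `Rossman2010_cliqueVsSubcritical` — **Theorem 1** (p. 4): with `δ = k⁻³` (or any
  sufficiently small `δ > 0`) and `p⁻ = n^{-2(1+δ)/(k-1)}`, a monotone fan-in-2 circuit of size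
  `O(n^{k/4})` with `E[C(random k-clique)] ≥ Ω(1)` has `E[C(G(n,p⁻))] ≥ 1 - exp(-n^{Ω(1)})`.
* `Rossman2010_twoThresholds` — **Theorem 2 in the strongest printed form** (p. 4): monotone
  fan-in-2 circuits solving `k`-clique a.a.s. on both `G(n,p)` and `G(n, p + p^{1+ε})`,
  `p ∈ Θ(n^{-2/(k-1)})`, `ε > 0` sufficiently small, have size `ω(n^{k/4})`; the headline form
  ("monotone circuits solving `k`-clique on random graphs have size `ω(n^{k/4})`", i.e. a.a.s.
  correct on `G(n,p)` for EVERY `p : ℕ → [0,1]`) is DERIVED from it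
  (`Rossman2010_twoThresholds.allDensities`, proved).
* `Rossman2010_upperBound` — **Theorem 3** (p. 4, §8 pp. 10–11): constant-depth unbounded
  fan-in monotone circuits of size `n^{k/4+O(1)}` solve `k`-clique on random graphs.
* `Rossman2010_plantedVsConditioned` — **Lemma 23** (Appendix B, p. 13): for
  `p ∈ Θ(n^{-2/(k-1)})`, the laws of `G(n,p) | {ω_k = 1}` and of `G(n,p) ∪ K_A | {ω_k(G) = 0}` are
  `o(1)`-close: `∑_H |Pr[G = H | ω_k(G) = 1] - Pr[G ∪ K_A = H | ω_k(G) = 0]| → 0`.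

## Vocabulary (definitions with bodies, in `Literature.Computability.Complexity`)

* `gnpProb n p S = ∑_{x ∈ S} gnpWeight n p x` (`gnpWeight`, `edgeCount`, `plantClique` from `Rossman2008.lean`)
  (`= Pr[G(n,p) ∈ S]`; finite sums, no measure theory — the shape inlined by route
  PneNP/OneSlice; Mathlib's `SimpleGraph.binomialRandom` gives the same singleton weights,
  `SimpleGraph.binomialRandom_singleton`, on `SimpleGraph (Fin n)` rather than edge vectors);
  PROVED: `gnpProb_nonneg`, `gnpProb_mono`, `gnpProb_univ` (total mass `1`), `gnpProb_le_one`,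
  `gnpProb_compl`.
* `kSubsetProb n k P = #{A ∈ ([n] choose k) : P A} / C(n,k)` (law of the uniformly random
  `k`-set, hence of the random `k`-clique `K_A = cliqueVec A` of `CliqueTestGraphs.lean`);
  junk value `0` when `n < k`.
* `cliqueCount n k x = ω_k`, with `cliqueCount_eq_zero_iff : ω_k(x) = 0 ↔ cliqueFn n k x = false`
  (PROVED), so that "`f(G) = 1 ⇔ ω_k(G) ≥ 1`" is `f x = cliqueFn n k x`.
* `SolvesCliqueAAS k p C` — the sequence of circuits `C n` is a.a.s. correct for `k`-CLIQUE on
  `G(n, p n)`: `gnpProb n (p n) {x | (C n).eval x ≠ cliqueFn n k x} → 0`.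
* `monotoneACBasis = {∧ₘ, ∨ₘ | m ∈ ℕ}` — unbounded fan-in monotone gates (the constants are
  `∧₀ = 1`, `∨₀ = 0`), the gates of §8.
* `condOneCliqueLaw`, `plantedCliqueFreeLaw` — the two conditional laws of Lemma 23.

## Design choices

* Circuit model. Rossman's monotone circuits (§2, p. 3) have inputs labelled by potential edges
  OR the constants `0, 1`, and `∧`/`∨` gates, of fan-in `2` in §5–7. This is exactly
  `monotoneBasis01 = {∧₂, ∨₂, 0, 1}` (`NegationElimination.lean`) in the straight-line model
  `Circuit` (size = number of gates). The lower bounds (Theorems 1, 2) are stated for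
  `monotoneBasis01` as printed; the versions for the constant-free basis `monotoneBasis` used by
  route PneNP/OneSlice follow by `IsOver.mono` and are PROVED
  (`Rossman2010Thm1At.of_monotoneBasis`, `Rossman2010_twoThresholds.monotoneBasis`).
* Asymptotic notation is read for SEQUENCES of circuits `C : (n : ℕ) → Circuit (edges of Kₙ)`,
  literally: "size `O(n^{k/4})`" is `∃ c, ∀ᶠ n, |C n| ≤ c · n^{k/4}`; "`E[…] ≥ Ω(1)`" is
  `∃ η > 0, ∀ᶠ n, η ≤ E[…]`; "`≥ 1 - exp(-n^{Ω(1)})`" is `∃ c' > 0, ∀ᶠ n, 1 - exp(-n^{c'}) ≤ …`;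
  "size `ω(n^{k/4})`" is `|C n| / n^{k/4} → ∞`; "`p ∈ Θ(n^{-2/(k-1)})`" is Mathlib's `IsTheta`
  along `atTop`. Basis membership is required eventually in `n` only (for `n ≤ 1` the edge set is
  empty and NO circuit over `{∧₂, ∨₂}` exists, which would make a `∀ n` hypothesis vacuous).
* Theorem 1's `δ`: the paper fixes "sufficiently small `δ > 0` (to be determined later, though
  `δ = k⁻³` suffices)" (p. 4); the fact records both readings (all `δ ∈ (0, δ₀]` for some
  `δ₀ > 0`, and `δ = k⁻³`) of the parametrised statement `Rossman2010Thm1At k δ`.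
* Not here: Lemma 17 (the two consequences of Lemma 23 used in §7), the intermediate variant of
  Theorem 2 with `G(n, 2p)`, the explicit exponents `k/4 + 1/2 + …` of §6, and the
  `(p,q)`-sunflower lemma (Lemma 6); the AC⁰ analogue [Rossman2008] is a different paper.
-/

noncomputable section

namespace Literature.Computability.Complexity

open Finset Filter Asymptotics
open scoped _root_.Topology

/-! ### `G(n,p)` as a finite sum over edge vectors -/

/-- `Pr[G(n,p) ∈ S]` for a finite set `S` of edge vectors: the sum over `S` of the `G(n,p)`-weights
`gnpWeight n p x = p^{e(x)} (1-p)^{C(n,2)-e(x)}` of `Rossman2008.lean` (Rossman 2010, §2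
"Erdős–Rényi random graphs": potential edges are included independently with probability `p`).
For `p ∉ [0,1]` this is just a polynomial expression in `p`. [cite: Rossman2010, §2 (p. 3)] -/
def gnpProb (n : ℕ) (p : ℝ) (S : Finset ((⊤ : SimpleGraph (Fin n)).edgeSet → Bool)) : ℝ :=
  ∑ x ∈ S, gnpWeight n p x

/-- Probabilities are nonnegative for `p ∈ [0,1]`. [folklore] -/
theorem gnpProb_nonneg {n : ℕ} {p : ℝ} (hp0 : 0 ≤ p) (hp1 : p ≤ 1)
    (S : Finset ((⊤ : SimpleGraph (Fin n)).edgeSet → Bool)) : 0 ≤ gnpProb n p S :=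
  sum_nonneg fun x _ => gnpWeight_nonneg hp0 hp1 x

/-- Monotonicity of `Pr[G(n,p) ∈ S]` in `S` for `p ∈ [0,1]`. [folklore] -/
theorem gnpProb_mono {n : ℕ} {p : ℝ} (hp0 : 0 ≤ p) (hp1 : p ≤ 1)
    {S T : Finset ((⊤ : SimpleGraph (Fin n)).edgeSet → Bool)} (h : S ⊆ T) :
    gnpProb n p S ≤ gnpProb n p T :=
  sum_le_sum_of_subset_of_nonneg h fun x _ _ => gnpWeight_nonneg hp0 hp1 x

/-- Unfolding lemma for events given as predicates:
`Pr[P(G(n,p))] = ∑ₓ [P x] · gnpWeight n p x`. [folklore] -/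
theorem gnpProb_filter {n : ℕ} (p : ℝ) (P : ((⊤ : SimpleGraph (Fin n)).edgeSet → Bool) → Prop)
    [DecidablePred P] :
    gnpProb n p (univ.filter P) = ∑ x, if P x then gnpWeight n p x else 0 := by
  rw [gnpProb, sum_filter]

/-- The number of potential edges is `C(n,2)` (local copy; the public lemma of this name lives in
`Rossman2008CliqueProofs.lean`). [folklore] -/
private theorem fintypeCard_edgeSet_top_fin (n : ℕ) :
    Fintype.card ((⊤ : SimpleGraph (Fin n)).edgeSet) = n.choose 2 := by
  classical
  rw [← SimpleGraph.edgeFinset_card, SimpleGraph.card_edgeFinset_top_eq_card_choose_two,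
    Fintype.card_fin]

/-- **Total mass**: `Pr[G(n,p) ∈ everything] = (p + (1 - p))^{C(n,2)} = 1` (the binomial theorem;
no hypothesis on `p`). [folklore] -/
theorem gnpProb_univ (n : ℕ) (p : ℝ) : gnpProb n p univ = 1 := by
  classical
  set ι := ((⊤ : SimpleGraph (Fin n)).edgeSet) with hι
  have key : gnpProb n p univ = ∑ s : Finset ι, p ^ #s * (1 - p) ^ (Fintype.card ι - #s) := by
    rw [gnpProb]
    refine Finset.sum_nbij' (fun x => univ.filter fun e => x e = true)
      (fun s => fun e => decide (e ∈ s)) (fun _ _ => mem_univ _) (fun _ _ => mem_univ _)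
      (fun x _ => ?_) (fun s _ => ?_) (fun x _ => ?_)
    · funext e
      by_cases hx : x e = true <;> simp [hx]
    · ext e
      simp
    · rw [gnpWeight, edgeCount, fintypeCard_edgeSet_top_fin]
  rw [key, Fintype.sum_pow_mul_eq_add_pow, add_sub_cancel, one_pow]

/-- Complements: `Pr[¬ E] = 1 - Pr[E]`. [folklore] -/
theorem gnpProb_compl {n : ℕ} (p : ℝ) (S : Finset ((⊤ : SimpleGraph (Fin n)).edgeSet → Bool)) :
    gnpProb n p Sᶜ = 1 - gnpProb n p S := by
  rw [eq_sub_iff_add_eq, gnpProb, gnpProb, Finset.sum_compl_add_sum, ← gnpProb, gnpProb_univ]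

/-- Probabilities are at most `1` for `p ∈ [0,1]`. [folklore] -/
theorem gnpProb_le_one {n : ℕ} {p : ℝ} (hp0 : 0 ≤ p) (hp1 : p ≤ 1)
    (S : Finset ((⊤ : SimpleGraph (Fin n)).edgeSet → Bool)) : gnpProb n p S ≤ 1 :=
  (gnpProb_mono hp0 hp1 (subset_univ S)).trans_eq (gnpProb_univ n p)

/-! ### The random `k`-clique and the clique count `ω_k` -/

/-- `Pr_A[P A]` for a uniformly random `k`-subset `A` of the `n` vertices — the law of the
*random `k`-clique* `K_A = cliqueVec A` (Rossman 2010, §2 "Cliques": "The random `k`-clique is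
the random graph `K_A` where `A` is uniformly distributed in `([n] choose k)`"). Junk value `0`
when `n < k` (then `C(n,k) = 0`). [cite: Rossman2010, §2 (p. 3)] -/
def kSubsetProb (n k : ℕ) (P : Finset (Fin n) → Prop) [DecidablePred P] : ℝ :=
  #((powersetCard k (univ : Finset (Fin n))).filter P) / (n.choose k : ℝ)

/-- `kSubsetProb` is a probability: `0 ≤ Pr_A[P A]`. [folklore] -/
theorem kSubsetProb_nonneg (n k : ℕ) (P : Finset (Fin n) → Prop) [DecidablePred P] :
    0 ≤ kSubsetProb n k P := by
  unfold kSubsetProb; positivity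

/-- `kSubsetProb` is a probability: `Pr_A[P A] ≤ 1`. [folklore] -/
theorem kSubsetProb_le_one (n k : ℕ) (P : Finset (Fin n) → Prop) [DecidablePred P] :
    kSubsetProb n k P ≤ 1 := by
  unfold kSubsetProb
  rcases Nat.eq_zero_or_pos (n.choose k) with h | h
  · simp [h]
  · rw [div_le_one (by exact_mod_cast h)]
    have := card_filter_le (powersetCard k (univ : Finset (Fin n))) P
    rw [card_powersetCard, card_univ, Fintype.card_fin] at this
    exact_mod_cast this

open Classical in
/-- `ω_k(G)`, the number of `k`-cliques of the graph with edge vector `x`: the number of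
`k`-sets `A` all of whose edges are on, i.e. with `K_A ⊆ G` (Rossman 2010, §2 "Cliques").
[cite: Rossman2010, §2 (p. 3)] -/
def cliqueCount (n k : ℕ) (x : (⊤ : SimpleGraph (Fin n)).edgeSet → Bool) : ℕ :=
  #((powersetCard k (univ : Finset (Fin n))).filter fun A => ∀ e, cliqueVec A e = true → x e = true)

/-- `K_A ⊆ G(x)` (all edges of the clique vector of `A` are on in `x`) iff `A` is a clique of the
graph of `x`. [folklore] -/
theorem cliqueVec_le_iff_isClique {n : ℕ} (A : Finset (Fin n))
    (x : (⊤ : SimpleGraph (Fin n)).edgeSet → Bool) :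
    (∀ e, cliqueVec A e = true → x e = true) ↔ (cliqueGraph x).IsClique (A : Set (Fin n)) := by
  constructor
  · intro h u hu v hv huv
    rw [cliqueGraph_adj]
    refine ⟨huv, h _ ?_⟩
    simp only [cliqueVec, decide_eq_true_eq]
    intro w hw
    rcases Sym2.mem_iff.1 hw with rfl | rfl
    · exact hu
    · exact hv
  · rintro h ⟨e, he⟩ hA
    induction e using Sym2.ind with
    | h u v =>
      have huv : u ≠ v := by simpa using he
      simp only [cliqueVec, decide_eq_true_eq] at hA
      have hu : u ∈ A := hA u (Sym2.mem_mk_left u v)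
      have hv : v ∈ A := hA v (Sym2.mem_mk_right u v)
      have hadj := h hu hv huv
      rw [cliqueGraph_adj] at hadj
      obtain ⟨_, hx⟩ := hadj
      exact hx

/-- **`ω_k = 0 ⇔ CLIQUE = 0`**: the graph of `x` has no `k`-clique iff `cliqueFn n k x = false`;
hence "`f(G) = 1 ⇔ ω_k(G) ≥ 1`" (Rossman 2010, §2) reads `f x = cliqueFn n k x`. [folklore] -/
theorem cliqueCount_eq_zero_iff {n k : ℕ} (x : (⊤ : SimpleGraph (Fin n)).edgeSet → Bool) :
    cliqueCount n k x = 0 ↔ cliqueFn n k x = false := by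
  classical
  rw [cliqueFn_eq_false_iff, cliqueCount, card_eq_zero, filter_eq_empty_iff]
  constructor
  · intro h A hA
    have hk : A ∈ powersetCard k (univ : Finset (Fin n)) :=
      mem_powersetCard.2 ⟨subset_univ _, hA.card_eq⟩
    exact h hk ((cliqueVec_le_iff_isClique A x).2 hA.isClique)
  · intro h A hA hle
    exact h A ⟨(cliqueVec_le_iff_isClique A x).1 hle, (mem_powersetCard.1 hA).2⟩

/-- `ω_k ≥ 1 ⇔ CLIQUE = 1`. [folklore] -/
theorem cliqueCount_ne_zero_iff {n k : ℕ} (x : (⊤ : SimpleGraph (Fin n)).edgeSet → Bool) :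
    cliqueCount n k x ≠ 0 ↔ cliqueFn n k x = true := by
  rw [Ne, cliqueCount_eq_zero_iff, Bool.not_eq_false]

/-! ### Solving `k`-clique a.a.s.; the unbounded fan-in monotone basis -/

/-- The sequence of circuits `C n` (one per number of vertices) *solves `k`-clique a.a.s. on
`G(n, p(n))`*: `Pr[C n (G) ≠ [ω_k(G) ≥ 1]] → 0` as `n → ∞` (Rossman 2010, §2, p. 4: "`f(G) = 1
⟺ ω_k(G) ⩾ 1` a.a.s. for `G = G(n,p)`"; `[ω_k ≥ 1] = cliqueFn n k` by `cliqueCount_ne_zero_iff`).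
[cite: Rossman2010, §2 (p. 4)] -/
def SolvesCliqueAAS (k : ℕ) (p : ℕ → ℝ)
    (C : (n : ℕ) → Circuit ((⊤ : SimpleGraph (Fin n)).edgeSet)) : Prop :=
  Tendsto (fun n => gnpProb n (p n) (univ.filter fun x => (C n).eval x ≠ cliqueFn n k x))
    atTop (𝓝 0)

/-- The unbounded fan-in monotone basis `{∧ₘ, ∨ₘ | m ∈ ℕ}` (conjunctions and disjunctions of
every arity; `∧₀`, `∨₀` are the constants `1`, `0`): the gates of the constant-depth monotone
circuits of Rossman 2010, §8 ("constant-depth monotone circuits with unbounded fan-in").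
[cite: Rossman2010, §2 and §8 (pp. 3, 10)] -/
def monotoneACBasis : Set GateFn := ⋃ m : ℕ, {GateFn.and m, GateFn.or m}

/-- `{∧ₘ, ∨ₘ | m} ⊆ acBasis = {¬} ∪ {∧ₘ, ∨ₘ | m}`. [folklore] -/
theorem monotoneACBasis_subset_acBasis : monotoneACBasis ⊆ acBasis :=
  Set.subset_union_right

/-- `{∧₂, ∨₂} ⊆ {∧ₘ, ∨ₘ | m}`. [folklore] -/
theorem monotoneBasis_subset_monotoneACBasis : monotoneBasis ⊆ monotoneACBasis := by
  intro g hg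
  simp only [monotoneBasis, Set.mem_insert_iff, Set.mem_singleton_iff] at hg
  simp only [monotoneACBasis, Set.mem_iUnion, Set.mem_insert_iff, Set.mem_singleton_iff]
  rcases hg with rfl | rfl
  · exact ⟨2, Or.inl rfl⟩
  · exact ⟨2, Or.inr rfl⟩

/-! ### Theorem 1: random `k`-cliques versus subcritical `G⁻` -/

/-- Theorem 1 of Rossman 2010 at the parameters `(k, δ)`, with `p⁻(n) = n^{-2(1+δ)/(k-1)}` (§3,
p. 4): for every sequence of monotone fan-in-2 circuits `C n` on the edges of `Kₙ` (over
`{∧₂, ∨₂, 0, 1}`, eventually in `n`) of size `O(n^{k/4})` such that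
`E[C n (random k-clique)] ≥ Ω(1)`, one has `E[C n (G(n, p⁻))] ≥ 1 - exp(-n^{Ω(1)})`. Read for
sequences: `∃ c, ∀ᶠ n, |C n| ≤ c·n^{k/4}` and `∃ η > 0, ∀ᶠ n, η ≤ Pr_A[C n (K_A) = 1]` imply
`∃ c' > 0, ∀ᶠ n, 1 - exp(-n^{c'}) ≤ Pr[C n (G(n,p⁻)) = 1]`. [cite: Rossman2010, Thm 1 (p. 4)] -/
def Rossman2010Thm1At (k : ℕ) (δ : ℝ) : Prop :=
  ∀ C : (n : ℕ) → Circuit ((⊤ : SimpleGraph (Fin n)).edgeSet),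
    (∀ᶠ n : ℕ in atTop, (C n).IsOver monotoneBasis01) →
    (∃ c : ℝ, ∀ᶠ n : ℕ in atTop, ((C n).size : ℝ) ≤ c * (n : ℝ) ^ ((k : ℝ) / 4)) →
    (∃ η : ℝ, 0 < η ∧ ∀ᶠ n : ℕ in atTop,
      η ≤ kSubsetProb n k (fun A => (C n).eval (cliqueVec A) = true)) →
    ∃ c' : ℝ, 0 < c' ∧ ∀ᶠ n : ℕ in atTop,
      1 - Real.exp (-((n : ℝ) ^ c')) ≤
        gnpProb n ((n : ℝ) ^ (-(2 * (1 + δ)) / ((k : ℝ) - 1)))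
          (univ.filter fun x => (C n).eval x = true)

/-- **Rossman 2010, Theorem 1** (p. 4). "Let `k ⩾ 5` … Fix sufficiently small `δ > 0` (to be
determined later, though `δ = k⁻³` suffices) and let `p⁻(n) = n^{-2(1+δ)/(k-1)}` … Let `C` be a
monotone circuit of size `O(n^{k/4})` such that `E[C(random k-clique)] ⩾ Ω(1)`. Then
`E[C(G⁻)] ⩾ 1 - exp(-n^{Ω(1)})`." Both printed readings of `δ` are recorded: the statement holds
for all sufficiently small `δ > 0`, and for `δ = k⁻³`. (Over the constant-free basis `{∧₂, ∨₂}`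
see `Rossman2010Thm1At.of_monotoneBasis`.) [cite: Rossman2010, Thm 1 (p. 4)] -/
def Rossman2010_cliqueVsSubcritical : Prop :=
  ∀ k : ℕ, 5 ≤ k →
    (∃ δ₀ : ℝ, 0 < δ₀ ∧ ∀ δ : ℝ, 0 < δ → δ ≤ δ₀ → Rossman2010Thm1At k δ) ∧
      Rossman2010Thm1At k (1 / (k : ℝ) ^ 3)

/-- Theorem 1 for circuits over the constant-free monotone basis `{∧₂, ∨₂}` (the basis of route
PneNP/OneSlice) is the special case `{∧₂, ∨₂} ⊆ {∧₂, ∨₂, 0, 1}`. [folklore] -/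
theorem Rossman2010Thm1At.of_monotoneBasis {k : ℕ} {δ : ℝ} (h : Rossman2010Thm1At k δ)
    (C : (n : ℕ) → Circuit ((⊤ : SimpleGraph (Fin n)).edgeSet))
    (hC : ∀ᶠ n : ℕ in atTop, (C n).IsOver monotoneBasis)
    (hsize : ∃ c : ℝ, ∀ᶠ n : ℕ in atTop, ((C n).size : ℝ) ≤ c * (n : ℝ) ^ ((k : ℝ) / 4))
    (hacc : ∃ η : ℝ, 0 < η ∧ ∀ᶠ n : ℕ in atTop,
      η ≤ kSubsetProb n k (fun A => (C n).eval (cliqueVec A) = true)) :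
    ∃ c' : ℝ, 0 < c' ∧ ∀ᶠ n : ℕ in atTop,
      1 - Real.exp (-((n : ℝ) ^ c')) ≤
        gnpProb n ((n : ℝ) ^ (-(2 * (1 + δ)) / ((k : ℝ) - 1)))
          (univ.filter fun x => (C n).eval x = true) :=
  h C (hC.mono fun _ hn => hn.mono monotoneBasis_subset_monotoneBasis01) hsize hacc

/-! ### Theorem 2: the `ω(n^{k/4})` lower bound at two thresholds -/

/-- **Rossman 2010, Theorem 2, strongest printed form** (p. 4). "Monotone circuits solving
`k`-clique on random graphs have size `ω(n^{k/4})`. … to state Theorem 2 in the strongest form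
that the proof entails, we can replace 'solves `k`-clique on random graphs' with 'solves
`k`-clique a.a.s. on `G(n, p)` and `G(n, 2p)` where `p ∈ Θ(n^{-2/(k-1)})`'; further, we can even
replace `2p` with `p + p^{1+ε}` for sufficiently small `ε > 0`." Formally: for `k ≥ 5` there is
`ε₀ > 0` such that for all `ε ∈ (0, ε₀]`, every `p : ℕ → [0,1]` with `p ∈ Θ(n^{-2/(k-1)})` and
every sequence `C n` of fan-in-2 monotone circuits (over `{∧₂, ∨₂, 0, 1}`, eventually) that is
a.a.s. correct for `k`-CLIQUE on `G(n, p)` AND on `G(n, p + p^{1+ε})` satisfies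
`|C n| / n^{k/4} → ∞`. (`p + p^{1+ε} ≤ 1` eventually, as `p → 0`.) The headline form over all
densities is `Rossman2010_twoThresholds.allDensities`; its single-threshold sharpening is the
open problem of §9 (route PneNP/OneSlice, `SingleThreshold`). [cite: Rossman2010, Thm 2 (p. 4)] -/
def Rossman2010_twoThresholds : Prop :=
  ∀ k : ℕ, 5 ≤ k → ∃ ε₀ : ℝ, 0 < ε₀ ∧ ∀ ε : ℝ, 0 < ε → ε ≤ ε₀ →
    ∀ p : ℕ → ℝ, (∀ n, 0 ≤ p n ∧ p n ≤ 1) →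
      (p =Θ[atTop] fun n => (n : ℝ) ^ (-(2 : ℝ) / ((k : ℝ) - 1))) →
      ∀ C : (n : ℕ) → Circuit ((⊤ : SimpleGraph (Fin n)).edgeSet),
        (∀ᶠ n : ℕ in atTop, (C n).IsOver monotoneBasis01) →
        SolvesCliqueAAS k p C → SolvesCliqueAAS k (fun n => p n + p n ^ (1 + ε)) C →
          Tendsto (fun n => ((C n).size : ℝ) / (n : ℝ) ^ ((k : ℝ) / 4)) atTop atTop

/-- Theorem 2 (strongest form) for circuits over the constant-free basis `{∧₂, ∨₂}`. [folklore] -/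
theorem Rossman2010_twoThresholds.monotoneBasis (h : Rossman2010_twoThresholds) {k : ℕ}
    (hk : 5 ≤ k) : ∃ ε₀ : ℝ, 0 < ε₀ ∧ ∀ ε : ℝ, 0 < ε → ε ≤ ε₀ →
    ∀ p : ℕ → ℝ, (∀ n, 0 ≤ p n ∧ p n ≤ 1) →
      (p =Θ[atTop] fun n => (n : ℝ) ^ (-(2 : ℝ) / ((k : ℝ) - 1))) →
      ∀ C : (n : ℕ) → Circuit ((⊤ : SimpleGraph (Fin n)).edgeSet),
        (∀ᶠ n : ℕ in atTop, (C n).IsOver monotoneBasis) →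
        SolvesCliqueAAS k p C → SolvesCliqueAAS k (fun n => p n + p n ^ (1 + ε)) C →
          Tendsto (fun n => ((C n).size : ℝ) / (n : ℝ) ^ ((k : ℝ) / 4)) atTop atTop := by
  obtain ⟨ε₀, hε₀, H⟩ := h k hk
  exact ⟨ε₀, hε₀, fun ε hε hεε₀ p hp hΘ C hC =>
    H ε hε hεε₀ p hp hΘ C (hC.mono fun _ hn => hn.mono monotoneBasis_subset_monotoneBasis01)⟩

/-- **Theorem 2, headline form** ("Monotone circuits solving `k`-clique on random graphs have
size `ω(n^{k/4})`", p. 4): a sequence of fan-in-2 monotone circuits that is a.a.s. correct for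
`k`-CLIQUE on `G(n, p)` for EVERY `p : ℕ → [0,1]` (§2, "solves `k`-clique on random graphs") has
`|C n| / n^{k/4} → ∞`. PROVED from the strongest form `Rossman2010_twoThresholds` by taking
`p = min (1/2, n^{-2/(k-1)})` (eventually the threshold function itself) and its companion
`p + p^{1+ε₀} ≤ 1`. [cite: Rossman2010, Thm 2 (p. 4)] -/
theorem Rossman2010_twoThresholds.allDensities (h : Rossman2010_twoThresholds) {k : ℕ}
    (hk : 5 ≤ k) (C : (n : ℕ) → Circuit ((⊤ : SimpleGraph (Fin n)).edgeSet))
    (hC : ∀ᶠ n : ℕ in atTop, (C n).IsOver monotoneBasis01)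
    (hsolve : ∀ p : ℕ → ℝ, (∀ n, 0 ≤ p n ∧ p n ≤ 1) → SolvesCliqueAAS k p C) :
    Tendsto (fun n => ((C n).size : ℝ) / (n : ℝ) ^ ((k : ℝ) / 4)) atTop atTop := by
  obtain ⟨ε₀, hε₀, H⟩ := h k hk
  -- the threshold function and its clamped version
  set θ : ℕ → ℝ := fun n => (n : ℝ) ^ (-(2 : ℝ) / ((k : ℝ) - 1)) with hθ
  set p : ℕ → ℝ := fun n => min (1 / 2) (θ n) with hp
  have hθ_nonneg : ∀ n, 0 ≤ θ n := fun n => Real.rpow_nonneg (Nat.cast_nonneg n) _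
  have hp_nonneg : ∀ n, 0 ≤ p n := fun n => le_min (by norm_num) (hθ_nonneg n)
  have hp_half : ∀ n, p n ≤ 1 / 2 := fun n => min_le_left _ _
  have hp01 : ∀ n, 0 ≤ p n ∧ p n ≤ 1 := fun n => ⟨hp_nonneg n, (hp_half n).trans (by norm_num)⟩
  -- `θ → 0`, so `p = θ` eventually and `p ∈ Θ(θ)`
  have hθ_tendsto : Tendsto θ atTop (𝓝 0) := by
    have hpos : 0 < (2 : ℝ) / ((k : ℝ) - 1) := by
      have hk' : (5 : ℝ) ≤ k := by exact_mod_cast hk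
      exact div_pos two_pos (by linarith)
    have h1 := (tendsto_rpow_neg_atTop hpos).comp tendsto_natCast_atTop_atTop
    refine h1.congr fun n => ?_
    simp only [Function.comp_apply, hθ, neg_div]
  have hpθ : p =ᶠ[atTop] θ :=
    (hθ_tendsto.eventually_le_const (by norm_num : (0 : ℝ) < 1 / 2)).mono
      fun n hn => min_eq_right hn
  have hΘ : p =Θ[atTop] θ := hpθ.isTheta
  -- the companion density `p + p^{1+ε₀}` is again a function into `[0,1]`
  have hp2 : ∀ n, 0 ≤ p n + p n ^ (1 + ε₀) ∧ p n + p n ^ (1 + ε₀) ≤ 1 := by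
    intro n
    have h1 : 0 ≤ p n ^ (1 + ε₀) := Real.rpow_nonneg (hp_nonneg n) _
    have h2 : p n ^ (1 + ε₀) ≤ p n :=
      Real.rpow_le_self_of_le_one (hp_nonneg n) (hp01 n).2 (by linarith)
    exact ⟨add_nonneg (hp_nonneg n) h1, by linarith [hp_half n]⟩
  exact H ε₀ hε₀ le_rfl p hp01 hΘ C hC (hsolve p hp01) (hsolve _ hp2)

/-! ### Theorem 3: the `n^{k/4+O(1)}` upper bound -/

/-- **Rossman 2010, Theorem 3** (p. 4; proof §8, pp. 10–11, monotonizing Amano's AC⁰ circuits).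
"There exist constant-depth monotone circuits of size `n^{k/4+O(1)}` which solve `k`-clique on
random graphs" — unbounded fan-in (§8), and "solve `k`-clique on random graphs" = a.a.s. correct
on `G(n, p)` for EVERY `p : ℕ → [0,1]` (§2, p. 4). Formally: for `k ≥ 5` there are a depth `d`,
an exponent shift `c` and circuits `C n` over `{∧ₘ, ∨ₘ | m}` of depth `≤ d` and, eventually, size
`≤ n^{k/4 + c}`, with `SolvesCliqueAAS k p C` for every `p : ℕ → [0,1]`.
[cite: Rossman2010, Thm 3 (p. 4)] -/
def Rossman2010_upperBound : Prop :=
  ∀ k : ℕ, 5 ≤ k → ∃ (d : ℕ) (c : ℝ) (C : (n : ℕ) → Circuit ((⊤ : SimpleGraph (Fin n)).edgeSet)),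
    (∀ n, (C n).IsOver monotoneACBasis) ∧ (∀ n, (C n).depth ≤ d) ∧
      (∀ᶠ n : ℕ in atTop, ((C n).size : ℝ) ≤ (n : ℝ) ^ ((k : ℝ) / 4 + c)) ∧
        ∀ p : ℕ → ℝ, (∀ n, 0 ≤ p n ∧ p n ≤ 1) → SolvesCliqueAAS k p C

/-! ### Lemma 23: planted versus conditioned at the threshold -/

open Classical in
/-- `Pr[G = H | ω_k(G) = 1]` for `G ∼ G(n,p)`: distribution (i) of Rossman 2010, Lemma 23
(Appendix B, p. 13). Junk value `0` if `Pr[ω_k(G) = 1] = 0`. [cite: Rossman2010, Lemma 23 (p. 13)] -/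
def condOneCliqueLaw (n k : ℕ) (p : ℝ) (H : (⊤ : SimpleGraph (Fin n)).edgeSet → Bool) : ℝ :=
  (if cliqueCount n k H = 1 then gnpWeight n p H else 0) /
    gnpProb n p (univ.filter fun x => cliqueCount n k x = 1)

open Classical in
/-- `Pr[G ∪ K_A = H | ω_k(G) = 0]` for `G ∼ G(n,p)` and an independent uniformly random `k`-set
`A` (`G ∪ K_A = plantClique A x`, the edgewise `or` with `cliqueVec A`): distribution (ii) of Rossman 2010,
Lemma 23 (Appendix B, p. 13), computed as
`(C(n,k)⁻¹ ∑_A Pr[G ∪ K_A = H ∧ ω_k(G) = 0]) / Pr[ω_k(G) = 0]`. Junk value `0` if `n < k` or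
`Pr[ω_k(G) = 0] = 0`. [cite: Rossman2010, Lemma 23 (p. 13)] -/
def plantedCliqueFreeLaw (n k : ℕ) (p : ℝ) (H : (⊤ : SimpleGraph (Fin n)).edgeSet → Bool) : ℝ :=
  (∑ A ∈ powersetCard k (univ : Finset (Fin n)),
      gnpProb n p (univ.filter fun x =>
        cliqueCount n k x = 0 ∧ plantClique A x = H)) /
    ((n.choose k : ℝ) * gnpProb n p (univ.filter fun x => cliqueCount n k x = 0))

/-- **Rossman 2010, Lemma 23** (Appendix B, p. 13). "For `p(n) ∈ Θ(n^{-2/(k-1)})` and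
`G = G(n,p)` and uniform random `A ∈ ([n] choose k)`, distributions (i) `G` conditioned on
`ω_k(G) = 1`, (ii) `G ∪ K_A` conditioned on `ω_k(G) = 0` have total variation distance `o(1)`.
That is, `∑_{n-vertex graphs H} |Pr[G = H | ω_k(G) = 1] - Pr[G ∪ K_A = H | ω_k(G) = 0]| < o(1)`."
Here `k ≥ 5` is the paper's standing assumption (§2). The contiguity tool behind Lemma 17 and
Theorem 2. [cite: Rossman2010, Lemma 23 (p. 13)] -/
def Rossman2010_plantedVsConditioned : Prop :=
  ∀ k : ℕ, 5 ≤ k → ∀ p : ℕ → ℝ, (∀ n, 0 ≤ p n ∧ p n ≤ 1) →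
    (p =Θ[atTop] fun n => (n : ℝ) ^ (-(2 : ℝ) / ((k : ℝ) - 1))) →
      Tendsto (fun n => ∑ H : (⊤ : SimpleGraph (Fin n)).edgeSet → Bool,
        |condOneCliqueLaw n k (p n) H - plantedCliqueFreeLaw n k (p n) H|) atTop (𝓝 0)

end Literature.Computability.Complexity
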